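import Literature.Topology.FourManifolds.MorseSeparateVariables
import Literature.Topology.FourManifolds.MorseExtrema
import Mathlib.Analysis.InnerProductSpace.Calculus
import HarnessLib

/-!
# Morse data read in the preferred chart; the squared distance

Topic `Literature/Topology/FourManifolds` (small sequel of `MorseSeparateVariables.lean`; fact seat
`provefact-Literature.Geometry.Symplectic.Oba2016_s-add47373d4`: the fibre term `m ∘ chart⁻¹` and the
base term `‖u - c₀‖²` of Kas' function of separate variables).  Everything is proved; no
definitions, no named facts.

* `mhessian_eq_mhessian_comp_symm`, `morseIndex_eq_morseIndex_comp_symm`,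
  `isMCriticalPt_iff_comp_symm` — at an interior point, the Hessian, the Morse index and
  criticality of `f` are those of `f ∘ (extChartAt I x)⁻¹` on the model space at `extChartAt I x x`
  (by definition, Milnor 1963, §2);
* `deriv_eq_zero_of_forall_ge` — a `C¹` function constant on `[a, ∞)` has `deriv = 0` there
  (at `a` by uniqueness of one-sided derivatives);
* `fderiv_normSqSub` (cf. `Literature.Analysis.FluidPDE.hasFDerivAt_norm_sub_sq`),
  `mhessian_normSqSub_apply`, `isMCriticalPt_normSqSub`,
  `nondegenerate_mhessian_normSqSub`, `morseIndex_normSqSub` — **`u ↦ ‖u - c‖²` has a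
  nondegenerate critical point of index `0` at `c`** with Hessian `2⟪·, ·⟫`.

## References

* J. Milnor, *Morse theory*, Annals of Mathematics Studies 51 (1963), §2. [Milnor1963]
-/

open scoped Manifold ContDiff Topology RealInnerProductSpace
open Set Function Filter

noncomputable section

namespace Literature.Topology.FourManifolds

universe u

/-! ### Morse data read in the preferred chart -/

section Written

variable {E : Type*} [NormedAddCommGroup E] [NormedSpace ℝ E] {H : Type*} [TopologicalSpace H]
  {I : ModelWithCorners ℝ E H} {M : Type u} [TopologicalSpace M] [ChartedSpace H M]

/-- **The Hessian at an interior point is the Hessian of `f ∘ chart⁻¹` on the model space.**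
[cite: Milnor1963, §2] -/
theorem mhessian_eq_mhessian_comp_symm [IsManifold I ∞ M] {f : M → ℝ} {x : M} (hx : I.IsInteriorPoint x) :
    mhessian I f x = mhessian 𝓘(ℝ, E) (f ∘ (extChartAt I x).symm) (extChartAt I x x) := by
  have hw : writtenInExtChartAt I 𝓘(ℝ, ℝ) x f = f ∘ (extChartAt I x).symm := by
    ext z; simp [writtenInExtChartAt]
  apply LinearMap.ext; intro v; apply LinearMap.ext; intro w
  rw [mhessian_apply_eq_fderiv_fderiv_of_isInteriorPoint' hx, mhessian_model_apply, hw]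

/-- **The Morse index at an interior point is that of `f ∘ chart⁻¹` on the model space.**
[cite: Milnor1963, §2] -/
theorem morseIndex_eq_morseIndex_comp_symm [IsManifold I ∞ M] {f : M → ℝ} {x : M}
    (hx : I.IsInteriorPoint x) :
    morseIndex I f x = morseIndex 𝓘(ℝ, E) (f ∘ (extChartAt I x).symm) (extChartAt I x x) := by
  unfold morseIndex
  rw [mhessian_eq_mhessian_comp_symm hx]

/-- **Criticality at an interior point is criticality of `f ∘ chart⁻¹` on the model space.**
[cite: Milnor1963, §2] -/
theorem isMCriticalPt_iff_comp_symm [IsManifold I ∞ M] {f : M → ℝ} {x : M} (hx : I.IsInteriorPoint x)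
    (hf : MDifferentiableAt I 𝓘(ℝ, ℝ) f x) :
    IsMCriticalPt I f x ↔ IsMCriticalPt 𝓘(ℝ, E) (f ∘ (extChartAt I x).symm) (extChartAt I x x) := by
  have hw : writtenInExtChartAt I 𝓘(ℝ, ℝ) x f = f ∘ (extChartAt I x).symm := by
    ext z; simp [writtenInExtChartAt]
  have hrange : range I ∈ 𝓝 (extChartAt I x x) := range_mem_nhds_isInteriorPoint hx
  have hd : DifferentiableAt ℝ (f ∘ (extChartAt I x).symm) (extChartAt I x x) := by
    have h := hf.differentiableWithinAt_writtenInExtChartAt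
    rw [hw] at h
    exact h.differentiableAt hrange
  rw [isMCriticalPt_iff_fderivWithin_writtenInExtChartAt_eq_zero (mem_extChartAt_source x) hf,
    isMCriticalPt_model_iff hd, hw, fderivWithin_of_mem_nhds hrange]

end Written

/-! ### Functions constant on a half-line -/

/-- A differentiable real function constant on `[a, ∞)` has vanishing derivative there (at `a`
by uniqueness of the one-sided derivative). [folklore] -/
theorem deriv_eq_zero_of_forall_ge {bb : ℝ → ℝ} (hbb : Differentiable ℝ bb) {a : ℝ}
    (h : ∀ t, a ≤ t → bb t = bb a) {t : ℝ} (ht : a ≤ t) : deriv bb t = 0 := by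
  rcases ht.lt_or_eq with hlt | heq
  · have hev : bb =ᶠ[𝓝 t] fun _ => bb a := by
      filter_upwards [Ioi_mem_nhds hlt] with s hs using h s hs.le
    rw [hev.deriv_eq, deriv_const]
  · subst heq
    have h1 : HasDerivWithinAt bb (deriv bb a) (Ici a) a := (hbb a).hasDerivAt.hasDerivWithinAt
    have h2 : HasDerivWithinAt bb 0 (Ici a) a :=
      (hasDerivWithinAt_const a (Ici a) (bb a)).congr (fun s hs => h s hs) (h a le_rfl)
    exact (uniqueDiffWithinAt_Ici a).eq_deriv _ h1 h2

/-! ### The squared distance to a point -/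

section NormSq

variable {E : Type*} [NormedAddCommGroup E] [InnerProductSpace ℝ E]

/-- `d(‖· - c‖²) = u ↦ 2⟪u - c, ·⟫`. [folklore] -/
theorem fderiv_normSqSub (c : E) :
    fderiv ℝ (fun v : E => ‖v - c‖ ^ 2) = fun u => (2 : ℝ) • innerSL ℝ (u - c) := by
  funext u
  have h : HasFDerivAt (fun v : E => ‖v - c‖ ^ 2)
      (2 • (innerSL ℝ (u - c)).comp (ContinuousLinearMap.id ℝ E)) u :=
    ((hasFDerivAt_id u).sub_const c).norm_sq
  rw [h.fderiv]
  ext w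
  simp [two_smul]

/-- The second derivative of `‖· - c‖²` is `2⟪·, ·⟫`. [folklore] -/
theorem fderiv_fderiv_normSqSub_apply (c u v w : E) :
    fderiv ℝ (fderiv ℝ (fun v : E => ‖v - c‖ ^ 2)) u v w = 2 * ⟪v, w⟫ := by
  rw [fderiv_normSqSub]
  have h1 : HasFDerivAt (fun u : E => innerSL ℝ (u - c))
      ((innerSL ℝ : E →L[ℝ] E →L[ℝ] ℝ).comp (ContinuousLinearMap.id ℝ E)) u :=
    ((innerSL ℝ : E →L[ℝ] E →L[ℝ] ℝ).hasFDerivAt).comp u ((hasFDerivAt_id u).sub_const c)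
  have h : HasFDerivAt (fun u : E => (2 : ℝ) • innerSL ℝ (u - c))
      ((2 : ℝ) • (innerSL ℝ : E →L[ℝ] E →L[ℝ] ℝ).comp (ContinuousLinearMap.id ℝ E)) u :=
    h1.const_smul (2 : ℝ)
  rw [h.fderiv]
  simp only [smul_apply, ContinuousLinearMap.coe_comp, comp_apply,
    ContinuousLinearMap.coe_id', id_eq, innerSL_apply_apply, smul_eq_mul]

/-- **`c` is a critical point of `‖· - c‖²`.** [folklore] -/
theorem isMCriticalPt_normSqSub (c : E) : IsMCriticalPt 𝓘(ℝ, E) (fun v : E => ‖v - c‖ ^ 2) c := by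
  have h : HasFDerivAt (fun v : E => ‖v - c‖ ^ 2)
      (2 • (innerSL ℝ (c - c)).comp (ContinuousLinearMap.id ℝ E)) c :=
    ((hasFDerivAt_id c).sub_const c).norm_sq
  have hd : DifferentiableAt ℝ (fun v : E => ‖v - c‖ ^ 2) c := h.differentiableAt
  rw [isMCriticalPt_model_iff hd, fderiv_normSqSub]
  simp only [sub_self, map_zero, smul_zero]

/-- The Hessian of `‖· - c‖²` at any point is `2⟪·, ·⟫`. [folklore] -/
theorem mhessian_normSqSub_apply (c u v w : E) :
    mhessian 𝓘(ℝ, E) (fun v : E => ‖v - c‖ ^ 2) u v w = 2 * ⟪v, w⟫ := by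
  rw [mhessian_model_apply, fderiv_fderiv_normSqSub_apply]

/-- **The Hessian of `‖· - c‖²` is nondegenerate.** [folklore] -/
theorem nondegenerate_mhessian_normSqSub (c u : E) :
    (mhessian 𝓘(ℝ, E) (fun v : E => ‖v - c‖ ^ 2) u).Nondegenerate := by
  refine ⟨fun v hv => ?_, fun v hv => ?_⟩
  · have h : mhessian 𝓘(ℝ, E) (fun v : E => ‖v - c‖ ^ 2) u v v = 0 := hv v
    rw [mhessian_normSqSub_apply] at h
    have h' : ⟪v, v⟫ = 0 := by linarith
    exact inner_self_eq_zero.1 h'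
  · have h : mhessian 𝓘(ℝ, E) (fun v : E => ‖v - c‖ ^ 2) u v v = 0 := hv v
    rw [mhessian_normSqSub_apply] at h
    have h' : ⟪v, v⟫ = 0 := by linarith
    exact inner_self_eq_zero.1 h'

/-- **`‖· - c‖²` has Morse index `0` at `c`** (a minimum). [cite: Milnor1963, §2] -/
theorem morseIndex_normSqSub [FiniteDimensional ℝ E] (c : E) :
    morseIndex 𝓘(ℝ, E) (fun v : E => ‖v - c‖ ^ 2) c = 0 := by
  have hs : ContMDiffAt 𝓘(ℝ, E) 𝓘(ℝ, ℝ) 2 (fun v : E => ‖v - c‖ ^ 2) c :=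
    (((contDiff_norm_sq ℝ).comp (contDiff_id.sub contDiff_const)).of_le (by norm_cast)).contMDiff.contMDiffAt
  have hmin : IsLocalMin (fun v : E => ‖v - c‖ ^ 2) c :=
    Filter.Eventually.of_forall fun u => by simp
  exact IsLocalMin.morseIndex_eq_zero hs hmin

end NormSq

end Literature.Topology.FourManifolds

end
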